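import Summits.QuantumFields.YangMills.Theorems.BrascampLiebVacuum.Negative.FalseWithoutLocality
import Literature.MathematicalPhysics.QuantumFieldTheory.SliceBottleneckCriterion

/-!
# `ConvexGribovBody.BrascampLiebVacuumSC` — negative lane: the Dirichlet form of the plaquette
# probe is bounded uniformly in the volume (refuter / standing disprover, crux stmt-QuantumFields-16404)

Support file for `Negative/DmaxFloor.lean`. In the vocabulary of the crux
`Summit.QuantumFields.YangMills.Theses.ConvexGribovBody.BrascampLiebVacuumSC` (verbatim `let`s:
`slope f U ℓ = limsup_{g → U_ℓ, g ≠ U_ℓ} |f(U[ℓ ↦ g]) − f U| / ‖ρ g − ρ(U_ℓ)‖_F`,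
`dir f = Σ_{t=0 spatial ℓ} ∫ (slope f U ℓ)² dμ`, `Dmax` the minimal-Coulomb-gauge covariance
scale), for the time-zero origin plaquette trace `f(U) = Re tr ρ(U_p)`:

* `slope_plaquette_nonneg_and_le` — `0 ≤ slope f U ℓ ≤ 4N⁴` everywhere (the link-Lipschitz
  bound `abs_re_trace_plaquette_sub_le` collapses to the single modified link;
  `limsup_nonneg_and_le` handles the junk value along `⊥`);
* `slope_plaquette_eq_zero` — `slope f U ℓ = 0` off the four links of `p`;
* `dir_plaquette_le` — hence `dir f ≤ 4 · (4N⁴)²`, UNIFORMLY in `S` and `β`.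

Everything proved; nothing here asserts a Theses statement.
-/

noncomputable section

open scoped BigOperators Topology Matrix ENNReal Matrix.Norms.Frobenius
open Filter MeasureTheory Function
open Literature.MathematicalPhysics.QuantumFieldTheory
open Summit.QuantumFields.YangMills.Theorems.BrascampLiebVacuum.Negative

namespace Summit.QuantumFields.YangMills.Theorems.BrascampLiebVacuumSC.Negative

section Slopes

variable {G : Type*} [Group G] [TopologicalSpace G] [IsTopologicalGroup G] [CompactSpace G]
  [MeasurableSpace G] [BorelSpace G]

omit [MeasurableSpace G] [BorelSpace G] [CompactSpace G] [IsTopologicalGroup G] in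
/-- The metric slope of the origin plaquette trace along any link lies in `[0, 4N⁴]`. [folklore] -/
theorem slope_plaquette_nonneg_and_le (r : LatticeRep G) {S : ℕ} (U : GaugeConfig 4 (2 * S + 1) G)
    (e : Edge 4 (2 * S + 1)) :
    0 ≤ Filter.limsup (fun g : G =>
        |(r.ρ (plaquetteHolonomy (Function.update U e g) 0 1 2)).trace.re -
            (r.ρ (plaquetteHolonomy U 0 1 2)).trace.re| /
          Real.sqrt (∑ a, ∑ b, ‖(r.ρ g - r.ρ (U e)) a b‖ ^ 2)) (𝓝[≠] (U e)) ∧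
      Filter.limsup (fun g : G =>
        |(r.ρ (plaquetteHolonomy (Function.update U e g) 0 1 2)).trace.re -
            (r.ρ (plaquetteHolonomy U 0 1 2)).trace.re| /
          Real.sqrt (∑ a, ∑ b, ‖(r.ρ g - r.ρ (U e)) a b‖ ^ 2)) (𝓝[≠] (U e)) ≤ 4 * (r.N : ℝ) ^ 4 := by
  refine limsup_nonneg_and_le _ (by positivity)
    (fun g => div_nonneg (abs_nonneg _) (Real.sqrt_nonneg _)) (Eventually.of_forall fun g => ?_)
  rw [sqrt_sum_sq_eq_norm]
  rcases (norm_nonneg (r.ρ g - r.ρ (U e))).eq_or_lt with h0 | hpos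
  · rw [← h0, div_zero]; positivity
  · rw [div_le_iff₀ hpos]
    have h := abs_re_trace_plaquette_sub_le r 0 1 2 (Function.update U e g) U
    have hsum : ∑ e', Real.sqrt (∑ a, ∑ b, ‖(r.ρ (Function.update U e g e') - r.ρ (U e')) a b‖ ^ 2) =
        ‖r.ρ g - r.ρ (U e)‖ := by
      rw [Finset.sum_eq_single e]
      · rw [Function.update_self, sqrt_sum_sq_eq_norm]
      · intro e' _ hne
        rw [Function.update_of_ne hne, sub_self]
        simp
      · intro h'; exact absurd (Finset.mem_univ e) h'
    rw [hsum] at h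
    exact h

omit [MeasurableSpace G] [BorelSpace G] [CompactSpace G] [IsTopologicalGroup G] in
/-- Off the four links of the origin plaquette the metric slope of its trace vanishes. [folklore] -/
theorem slope_plaquette_eq_zero (r : LatticeRep G) {S : ℕ} (U : GaugeConfig 4 (2 * S + 1) G)
    {e : Edge 4 (2 * S + 1)}
    (he : e ∉ ({((0 : Site 4 (2 * S + 1)), (1 : Fin 4)), (Site.shift 0 1, 2), (Site.shift 0 2, 1),
      (0, 2)} : Finset (Edge 4 (2 * S + 1)))) :
    Filter.limsup (fun g : G =>
        |(r.ρ (plaquetteHolonomy (Function.update U e g) 0 1 2)).trace.re -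
            (r.ρ (plaquetteHolonomy U 0 1 2)).trace.re| /
          Real.sqrt (∑ a, ∑ b, ‖(r.ρ g - r.ρ (U e)) a b‖ ^ 2)) (𝓝[≠] (U e)) = 0 := by
  have h1 : (((0 : Site 4 (2 * S + 1)), (1 : Fin 4)) : Edge 4 (2 * S + 1)) ≠ e :=
    fun h => he (by rw [← h]; simp)
  have h2 : ((Site.shift (0 : Site 4 (2 * S + 1)) 1, (2 : Fin 4)) : Edge 4 (2 * S + 1)) ≠ e :=
    fun h => he (by rw [← h]; simp)
  have h3 : ((Site.shift (0 : Site 4 (2 * S + 1)) 2, (1 : Fin 4)) : Edge 4 (2 * S + 1)) ≠ e :=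
    fun h => he (by rw [← h]; simp)
  have h4 : (((0 : Site 4 (2 * S + 1)), (2 : Fin 4)) : Edge 4 (2 * S + 1)) ≠ e :=
    fun h => he (by rw [← h]; simp)
  have hhol : ∀ g, plaquetteHolonomy (Function.update U e g) 0 1 2 = plaquetteHolonomy U 0 1 2 := by
    intro g
    simp only [plaquetteHolonomy, Function.update_of_ne h1, Function.update_of_ne h2,
      Function.update_of_ne h3, Function.update_of_ne h4]
  simp_rw [hhol, sub_self, abs_zero, zero_div]
  exact limsup_const_zero _

/-- **The time-zero Dirichlet form of the origin plaquette trace is `≤ 4 · (4N⁴)²`, uniformly in the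
volume** (crux vocabulary: `dir f = Σ_{t=0 spatial ℓ} ∫ slope² dμ`). [folklore] -/
theorem dir_plaquette_le (r : LatticeRep G) (β : ℝ) (S : ℕ) :
    let μ := wilsonMeasure (d := 4) (L := 2 * S + 1) r.ρ β
    let fro : Matrix (Fin r.N) (Fin r.N) ℂ → ℝ := fun M => ∑ a, ∑ b, ‖M a b‖ ^ 2
    let slope : (GaugeConfig 4 (2 * S + 1) G → ℝ) → GaugeConfig 4 (2 * S + 1) G →
        Edge 4 (2 * S + 1) → ℝ := fun f U e =>
      Filter.limsup (fun g : G => |f (Function.update U e g) - f U| /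
        Real.sqrt (fro (r.ρ g - r.ρ (U e)))) (𝓝[≠] (U e))
    let dir : (GaugeConfig 4 (2 * S + 1) G → ℝ) → ℝ := fun f =>
      ∑ e : Edge 4 (2 * S + 1), (if e.1 0 = 0 ∧ e.2 ≠ 0 then ∫ U, (slope f U e) ^ 2 ∂μ else 0)
    dir (fun U => (r.ρ (plaquetteHolonomy U 0 1 2)).trace.re) ≤ 4 * (4 * (r.N : ℝ) ^ 4) ^ 2 := by
  intro μ fro slope dir
  haveI : SecondCountableTopology G :=
    (r.continuous.isClosedEmbedding r.injective).isEmbedding.secondCountableTopology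
  haveI := isProbabilityMeasure_wilsonMeasure (d := 4) (L := 2 * S + 1) r.ρ r.continuous β
  set E₀ : Finset (Edge 4 (2 * S + 1)) := {((0 : Site 4 (2 * S + 1)), (1 : Fin 4)),
    (Site.shift 0 1, 2), (Site.shift 0 2, 1), (0, 2)} with hE₀
  set K : ℝ := 4 * (r.N : ℝ) ^ 4 with hK
  have hterm : ∀ e : Edge 4 (2 * S + 1),
      (if e.1 0 = 0 ∧ e.2 ≠ 0 then
        ∫ U, (slope (fun U => (r.ρ (plaquetteHolonomy U 0 1 2)).trace.re) U e) ^ 2 ∂μ else 0) ≤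
      (if e ∈ E₀ then K ^ 2 else 0) := by
    intro e
    by_cases he : e ∈ E₀
    · rw [if_pos he]
      split_ifs
      · have hpt : ∀ U, (slope (fun U => (r.ρ (plaquetteHolonomy U 0 1 2)).trace.re) U e) ^ 2 ≤ K ^ 2 :=
          fun U => by
            have h := slope_plaquette_nonneg_and_le r U e
            exact pow_le_pow_left₀ h.1 h.2 2
        calc _ ≤ ∫ _U, K ^ 2 ∂μ := integral_mono_of_nonneg (Eventually.of_forall fun U => sq_nonneg _)
              (integrable_const _) (Eventually.of_forall hpt)
          _ = K ^ 2 := by rw [integral_const, smul_eq_mul, probReal_univ, one_mul]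
      · positivity
    · rw [if_neg he]
      split_ifs
      · have h0 : ∀ U, slope (fun U => (r.ρ (plaquetteHolonomy U 0 1 2)).trace.re) U e = 0 :=
          fun U => slope_plaquette_eq_zero r U he
        simp [h0]
      · exact le_rfl
  calc dir (fun U => (r.ρ (plaquetteHolonomy U 0 1 2)).trace.re)
      ≤ ∑ e : Edge 4 (2 * S + 1), (if e ∈ E₀ then K ^ 2 else 0) := Finset.sum_le_sum fun e _ => hterm e
    _ = ∑ e ∈ E₀, K ^ 2 := by rw [Finset.sum_ite_mem, Finset.univ_inter]
    _ = E₀.card * K ^ 2 := by rw [Finset.sum_const, nsmul_eq_mul]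
    _ ≤ 4 * K ^ 2 := by
        refine mul_le_mul_of_nonneg_right ?_ (by positivity)
        have h : E₀.card ≤ 4 := by
          rw [hE₀]
          refine (Finset.card_insert_le _ _).trans ?_
          refine (Nat.succ_le_succ (Finset.card_insert_le _ _)).trans ?_
          refine (Nat.succ_le_succ (Nat.succ_le_succ (Finset.card_insert_le _ _))).trans ?_
          rw [Finset.card_singleton]
        exact_mod_cast h

end Slopes


end Summit.QuantumFields.YangMills.Theorems.BrascampLiebVacuumSC.Negative

end
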